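import Summits.CriticalPhenomena.PercolationContinuityZ3.Theorems.Transplant.SkelPhiForcedColumnPlace
import HarnessLib

/-!
# N2 (frames-only node `SamePDropOfSkeletonFrm₁`, OPEN), (S0) kit tier, Skel side — J12 REPAIR, part 1b: **THE FORCED KIT RE-CENTRED AT THE COLUMN END**
# (`Skelφ.forcedGeomC`, `Skelφ.kitOK_forcedC`; successor of `SkelPhiForcedKitDefs` p338315 under new names, no edit of landed text)

J12 (stmt-g20 2026-08-23T03:04:23Z, kernel certificate `kitZoneRows_absurd`; lead g11 03:05:11Z/03:06:24Z; p1-g17 03:09:30Z/03:12:38Z): in `kitOK_forced`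
the zone datum sits about N1's CHOSEN centre `ctCtr x = colPt …` (a `Classical.choose` over the kit point), so the row `hcol` (the column's END in the zone)
needed `Λc ⊇ cylBallFin c kz Rk`, `Rk ≥ cylRadMax types kz (2·KCmax)` — jointly unsatisfiable with `Λc ⊆ Rg ⊆ B_G(c, Rs)`, `Rs + 1 ≤ shellD ≤ KCmax`.
REPAIR (B) 're-centre': the column end `ctColEnd x` (SkelPhiForcedColumn) satisfies the SAME two facts as `ctCtr x` — `φ (ctColEnd x) = kitPt …`
(`φ_ctColEnd`) and `ctColEnd x ∈ B_G(t₁, kitK …)` (`walk_mem_graphBall`) — so every placement lemma holds for it with the same proof (§1), and with the zone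
datum ABOUT THE COLUMN END the column row is the zone's own `c ∈ Λc c kz` (§3: `hcol` ↦ `hcz`; NO `cylRadMax`/`cylBallFin`/`Frames`/`CylConn` row).
The order of constants becomes acyclic: LEVEL 0 fixes `(kz, Λc, Rs := graph extent of Λc)`, then `shellD ≥ Rs + 1`, then `KCmax`, then `A, tanOff, cU, cS, rs, r₀`.
builds on p205010 (kernel theorem, internal audit signed; external expert review pending) — nothing in this file uses p205010; nothing here is a
claim about the open node `SamePDropOfSkeletonFrm₁`.
Lane `prim-bschramm`, seat `prim-bschramm-p1` (gen 17); helper file (`--supports stmt-CriticalPhenomena-4575 --as helper`).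
* (§1 placement of the column end: part 1a `SkelPhiForcedColumnPlace`);
* §2 **`forcedGeomC`** (+ `_U_of_near/_U_of_far/_S_of_near/_S_of_far/_y/_U_subset_S`);  §3 **`kitOK_forcedC`** (= `kitOK_forced` with `hcol ↦ hcz`).
[cite: KozmaNitzan2024, §4 Lemma 10, p. 19 (Step III: seeds), p. 26 ((29): columns)] [cite: GrimmettPercolation1999, §7.2]
-/

noncomputable section

open scoped Classical

namespace Summit.CriticalPhenomena.PercolationContinuityZ3.Theorems.Transplant

namespace Skelφ

open MeasureTheory
open Literature.Probability.Percolation Literature.Probability.LatticeModels SimpleGraph KNLevels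
open Literature.Probability.Percolation.KozmaNitzan.Cells (oth oth_ne eq_oth_of_ne oth_oth)
open Literature.Barriers.CriticalPhenomena (graphBall graphBall_finite mem_graphBall_self graphBall_mono)
open Skel (winGraph winGraph_adj winGraph_le KitGeom)
open SkelI (tanOff tanTgt tanTgt_mem)

variable {V : Type} [DecidableEq V] {G : SimpleGraph V} [G.LocallyFinite] {ψ φ : V → Site 2}

/-! ## §2 The re-centred forced kit geometry -/

section Geom

variable (G) {Lo Hi : Site 2} (SF : ∀ (i : Fin 2) (σ : ℤˣ), SideForm ψ φ Lo Hi i σ) (P : ApronPrm) (w₀ : V) (R : ℕ)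
  (Λc : V → ℕ → Finset V) (kz : ℕ)

/-- **The re-centred forced kit geometry** of the window level (J12 repair of `forcedGeom`): a NEAR contact gets the seed region `wired path ∪ column ∪ zone
datum about the COLUMN END` and the face `= that zone datum`; a FAR contact gets `{y}`, `{y}` (edge-contact remedy). [this work — T4-S0 v1.1 §3/§10] -/
def forcedGeomC : KitGeom V where
  y := ctY G ψ w₀ R Lo Hi
  S := fun x => if IsNear G ψ Lo Hi P w₀ R x then ctWire G ψ P w₀ R Lo Hi x ∪ ctCol G SF P w₀ R x ∪ Λc (ctColEnd G SF P w₀ R x) kz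
    else {ctY G ψ w₀ R Lo Hi x}
  U := fun x => if IsNear G ψ Lo Hi P w₀ R x then Λc (ctColEnd G SF P w₀ R x) kz else {ctY G ψ w₀ R Lo Hi x}

variable {G SF P w₀ R Λc kz}

omit [G.LocallyFinite] in
/-- The face of a near contact. [folklore] -/
theorem forcedGeomC_U_of_near {x : V} (h : IsNear G ψ Lo Hi P w₀ R x) : (forcedGeomC G SF P w₀ R Λc kz).U x = Λc (ctColEnd G SF P w₀ R x) kz := by
  simp only [forcedGeomC, if_pos h]

omit [G.LocallyFinite] in
/-- The face of a far contact. [folklore] -/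
theorem forcedGeomC_U_of_far {x : V} (h : ¬ IsNear G ψ Lo Hi P w₀ R x) : (forcedGeomC G SF P w₀ R Λc kz).U x = {ctY G ψ w₀ R Lo Hi x} := by
  simp only [forcedGeomC, if_neg h]

omit [G.LocallyFinite] in
/-- The seed region of a near contact. [folklore] -/
theorem forcedGeomC_S_of_near {x : V} (h : IsNear G ψ Lo Hi P w₀ R x) :
    (forcedGeomC G SF P w₀ R Λc kz).S x = ctWire G ψ P w₀ R Lo Hi x ∪ ctCol G SF P w₀ R x ∪ Λc (ctColEnd G SF P w₀ R x) kz := by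
  simp only [forcedGeomC, if_pos h]

omit [G.LocallyFinite] in
/-- The seed region of a far contact. [folklore] -/
theorem forcedGeomC_S_of_far {x : V} (h : ¬ IsNear G ψ Lo Hi P w₀ R x) : (forcedGeomC G SF P w₀ R Λc kz).S x = {ctY G ψ w₀ R Lo Hi x} := by
  simp only [forcedGeomC, if_neg h]

omit [G.LocallyFinite] in
/-- The inner neighbour map. [folklore] -/
theorem forcedGeomC_y (x : V) : (forcedGeomC G SF P w₀ R Λc kz).y x = ctY G ψ w₀ R Lo Hi x := rfl

omit [G.LocallyFinite] in
/-- The face lies in the seed region. [folklore] -/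
theorem forcedGeomC_U_subset_S (x : V) : (forcedGeomC G SF P w₀ R Λc kz).U x ⊆ (forcedGeomC G SF P w₀ R Λc kz).S x := by
  simp only [forcedGeomC]
  split_ifs
  · exact Finset.subset_union_right
  · exact subset_rfl

end Geom

/-! ## §3 The re-centred forced kit geometry satisfies `KitOK` -/

section OK

variable {w₀ : V} {R : ℕ}

/-- **THE RE-CENTRED FORCED KIT GEOMETRY SATISFIES `KitOK`** (J12 repair of `kitOK_forced`: the centre IS the column end, so the column row `hcol` is the
zone's own `hcz`; no `cylRadMax`/`cylBallFin` row): hypotheses = the window level's widths, the column bound `hKC`, the centre's placement (`0 ≤ A`, `hθA`),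
the short region `Rg c ⊆ B_G(c, Rs)` with `≤ cU` vertices (`Rs` = the graph extent of the LEVEL-0 zone, fixed BEFORE `shellD`), and the zone datum `Λc`
(inside `Rg c`, connected from `c` inside itself, containing `c`), with the radii `r₀ / rs / cS`.
[cite: KozmaNitzan2024, §4 Lemma 10, p. 19 (Step III)] -/
theorem kitOK_forcedC {lo hi : Site 2} {j : ℕ} (SF : ∀ (i : Fin 2) (σ : ℤˣ), SideForm ψ φ (lo - (j : Site 2)) (hi + (j : Site 2)) i σ)
    (Rg : V → Finset V) {P : ApronPrm} {KCmax Rs rs cS cU : ℕ}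
    (hlip : Lip G ψ) (hq : QStepsN G ψ P.N) (hstep : Steps G φ)
    (hwide : ∀ i, (lo - (j : Site 2)) i + 2 * tanOff P.ℓs P.M ≤ (hi + (j : Site 2)) i)
    (hdw : ∀ i, (lo - (j : Site 2)) i + (P.d + 2 : ℕ) ≤ (hi + (j : Site 2)) i)
    (hKC : ∀ (i : Fin 2) (σ : ℤˣ) (z : Site 2), (SF i σ).θ (1 + P.d) ≤ (SF i σ).lin z → (SF i σ).lin z < (SF i σ).θ (2 + P.d) →
      (SF i σ).kitK z (shellD P) P.A ≤ KCmax)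
    (hA : 0 ≤ P.A) (hθA : ∀ (i : Fin 2) (σ : ℤˣ), (SF i σ).θ (2 + P.d) ≤ (SF i σ).θ (shellD P) + P.A)
    (hr₀ : P.N * (tanOff P.ℓs P.M + 2) + P.N * P.d + (KCmax + Rs) ≤ P.r₀) (hR : P.r₀ ≤ R)
    (hT : (shellD P : ℤ) + KCmax + Rs ≤ tanOff P.ℓs P.M)
    (hDw : ∀ i, (lo - (j : Site 2)) i + ((shellD P + 1 + P.d + KCmax + Rs : ℕ) : ℤ) ≤ (hi + (j : Site 2)) i) (hDρ : Rs + 1 ≤ shellD P)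
    (hRg : ∀ c, ∀ u ∈ Rg c, u ∈ graphBall G c Rs) (hRgcard : ∀ c, (Rg c).card ≤ cU) (hcU1 : 1 ≤ cU)
    (hrs : 1 + (P.N * (tanOff P.ℓs P.M + 2) + P.N * P.d + (KCmax + Rs)) ≤ rs)
    (hcS : (P.N + 1) * (tanOff P.ℓs P.M + 1) + (P.N + 1) * P.d + (KCmax + 1) + cU ≤ cS)
    {Λc : V → ℕ → Finset V} {kz : ℕ} (hΛRg : ∀ c, Λc c kz ⊆ Rg c) (hzconn : ∀ c, ∀ s ∈ Λc c kz, PathIn G (↑(Λc c kz) : Set V) c s)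
    (hcz : ∀ c, c ∈ Λc c kz) :
    KitOK G ψ w₀ R lo hi j rs cS cU (forcedGeomC G SF P w₀ R Λc kz) := by
  set K := outerBoundary (winGraph G w₀ R) (winLevel G ψ w₀ R lo hi j) with hKdef
  have hKeq : winLevel G ψ w₀ R lo hi j = Win G ψ w₀ (Finset.Icc (lo - (j : Site 2)) (hi + (j : Site 2))) R := rfl
  have hx' : ∀ x ∈ K, x ∈ outerBoundary (winGraph G w₀ R) (Win G ψ w₀ (Finset.Icc (lo - (j : Site 2)) (hi + (j : Site 2))) R) := fun x hx => hx
  have hw2 : ∀ i, (lo - (j : Site 2)) i + 2 ≤ (hi + (j : Site 2)) i := fun i => by have := hwide i; unfold tanOff at this; omega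
  have h1cS : 1 ≤ cS := by omega
  have hy : ∀ x ∈ K, G.Adj x (ctY G ψ w₀ R (lo - (j : Site 2)) (hi + (j : Site 2)) x) ∧ ctY G ψ w₀ R (lo - (j : Site 2)) (hi + (j : Site 2)) x ∈ graphBall G w₀ R ∧ ψ (ctY G ψ w₀ R (lo - (j : Site 2)) (hi + (j : Site 2)) x) ∈ Finset.Icc (lo - (j : Site 2)) (hi + (j : Site 2)) :=
    fun x hx => inNbr_spec (hx' x hx)
  have hyW : ∀ x ∈ K, ctY G ψ w₀ R (lo - (j : Site 2)) (hi + (j : Site 2)) x ∈ winLevel G ψ w₀ R lo hi j := fun x hx => by rw [hKeq, mem_Win]; exact ⟨(hy x hx).2.1, (hy x hx).2.2⟩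
  have hy1 : ∀ x ∈ K, ctY G ψ w₀ R (lo - (j : Site 2)) (hi + (j : Site 2)) x ∈ graphBall G x 1 := fun x hx =>
    BoxProdZ2.mem_graphBall_succ_of_adj G (mem_graphBall_self G x 0) (hy x hx).1
  -- radii from the inner neighbour
  set r₁ : ℕ := P.N * (tanOff P.ℓs P.M + 2) + P.N * P.d + (KCmax + Rs) with hr₁
  have hNle : P.N * (tanOff P.ℓs P.M + 1) ≤ P.N * (tanOff P.ℓs P.M + 2) := Nat.mul_le_mul_left P.N (by omega)
  have hr₀' : P.N * (tanOff P.ℓs P.M + 1) + P.N * P.d + (KCmax + Rs) ≤ P.r₀ := by omega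
  -- the centre, the short region and the zone box
  have hctrB : ∀ x ∈ K, ctColEnd G SF P w₀ R x ∈ graphBall G (ctY G ψ w₀ R (lo - (j : Site 2)) (hi + (j : Site 2)) x) (P.N * (tanOff P.ℓs P.M + 1) + P.N * P.d + KCmax) := by
    intro x hx
    have h := ctColEnd_mem_graphBall_kitK SF (P := P) (w₀ := w₀) (R := R) hstep x
    exact BoxProdZ2.mem_graphBall_add G (ctT1_mem_graphBall hq hwide (hx' x hx)) (graphBall_mono G _ (kitK_ctT1_le hlip hq hw2 hKC (hx' x hx)) h)
  have hRgB : ∀ x ∈ K, ∀ u ∈ Rg (ctColEnd G SF P w₀ R x), u ∈ graphBall G (ctY G ψ w₀ R (lo - (j : Site 2)) (hi + (j : Site 2)) x) r₁ := by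
    intro x hx u hu
    have h := BoxProdZ2.mem_graphBall_add G (hctrB x hx) (hRg _ u hu)
    exact graphBall_mono G _ (by omega) h
  have hRgW : ∀ x ∈ K, IsNear G ψ (lo - (j : Site 2)) (hi + (j : Site 2)) P w₀ R x → Rg (ctColEnd G SF P w₀ R x) ⊆ winLevel G ψ w₀ R lo hi j := fun x hx hnear v hv =>
    ball_ctColEnd_subset_winLevel SF hlip hq hstep hwide hKC hA hθA hr₀' hR hT hDw hDρ hx hnear v (hRg _ v hv)
  -- the wired path
  have hwireB : ∀ x ∈ K, ∀ v ∈ ctWire G ψ P w₀ R (lo - (j : Site 2)) (hi + (j : Site 2)) x, v ∈ graphBall G (ctY G ψ w₀ R (lo - (j : Site 2)) (hi + (j : Site 2)) x) r₁ := by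
    intro x hx v hv
    have h := ctWire_subset_graphBall' hq hwide (hx' x hx) v hv
    exact graphBall_mono G _ (by omega) h
  have hwireW : ∀ x ∈ K, IsNear G ψ (lo - (j : Site 2)) (hi + (j : Site 2)) P w₀ R x → ctWire G ψ P w₀ R (lo - (j : Site 2)) (hi + (j : Site 2)) x ⊆ winLevel G ψ w₀ R lo hi j := by
    intro x hx hnear v hv
    have hball : v ∈ graphBall G w₀ R := by
      have h := BoxProdZ2.mem_graphBall_add G hnear (graphBall_mono G _ (show r₁ ≤ P.r₀ by omega) (hwireB x hx v hv))
      rwa [Nat.sub_add_cancel hR] at h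
    rw [hKeq, mem_Win]
    exact ⟨hball, mem_Icc_of_mem_ctWire hlip hq hwide hdw (hx' x hx) hv⟩
  -- the column
  have hcolB : ∀ x ∈ K, ∀ v ∈ ctCol G SF P w₀ R x, v ∈ graphBall G (ctY G ψ w₀ R (lo - (j : Site 2)) (hi + (j : Site 2)) x) r₁ := by
    intro x hx v hv
    have h := BoxProdZ2.mem_graphBall_add G (ctT1_mem_graphBall hq hwide (hx' x hx)) (ctCol_subset_graphBall hlip hq hstep hw2 hKC (hx' x hx) v hv)
    exact graphBall_mono G _ (by omega) h
  have hcolW : ∀ x ∈ K, IsNear G ψ (lo - (j : Site 2)) (hi + (j : Site 2)) P w₀ R x → ctCol G SF P w₀ R x ⊆ winLevel G ψ w₀ R lo hi j := fun x hx hnear v hv => by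
    rw [hKeq]
    exact mem_winLevel_of_mem_ctCol hlip hq hstep hwide hKC (by omega) hR (by omega)
      (fun i => by have := hDw i; push_cast at this ⊢; omega) (hx' x hx) hnear v hv
  -- the near region and its connectivity
  have hregB : ∀ x ∈ K, IsNear G ψ (lo - (j : Site 2)) (hi + (j : Site 2)) P w₀ R x → ∀ v ∈ (forcedGeomC G SF P w₀ R Λc kz).S x, v ∈ graphBall G (ctY G ψ w₀ R (lo - (j : Site 2)) (hi + (j : Site 2)) x) r₁ := by
    intro x hx hnear v hv
    rw [forcedGeomC_S_of_near hnear] at hv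
    rcases Finset.mem_union.1 hv with hv | hv
    · rcases Finset.mem_union.1 hv with hv | hv
      · exact hwireB x hx v hv
      · exact hcolB x hx v hv
    · exact hRgB x hx v (hΛRg _ hv)
  have hregW : ∀ x ∈ K, IsNear G ψ (lo - (j : Site 2)) (hi + (j : Site 2)) P w₀ R x → (forcedGeomC G SF P w₀ R Λc kz).S x ⊆ winLevel G ψ w₀ R lo hi j := by
    intro x hx hnear v hv
    rw [forcedGeomC_S_of_near hnear] at hv
    rcases Finset.mem_union.1 hv with hv | hv
    · rcases Finset.mem_union.1 hv with hv | hv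
      · exact hwireW x hx hnear hv
      · exact hcolW x hx hnear hv
    · exact hRgW x hx hnear (hΛRg _ hv)
  have hregP : ∀ x ∈ K, IsNear G ψ (lo - (j : Site 2)) (hi + (j : Site 2)) P w₀ R x → ∀ v ∈ (forcedGeomC G SF P w₀ R Λc kz).S x,
      PathIn G (↑((forcedGeomC G SF P w₀ R Λc kz).S x) : Set V) (ctY G ψ w₀ R (lo - (j : Site 2)) (hi + (j : Site 2)) x) v := by
    intro x hx hnear v hv
    have hSx := forcedGeomC_S_of_near (G := G) (SF := SF) (P := P) (w₀ := w₀) (R := R) (Λc := Λc) (kz := kz) hnear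
    have hAw : ∀ u ∈ ctWire G ψ P w₀ R (lo - (j : Site 2)) (hi + (j : Site 2)) x, u ∈ (↑((forcedGeomC G SF P w₀ R Λc kz).S x) : Set V) := fun u hu => by
      rw [Finset.mem_coe, hSx]; exact Finset.mem_union_left _ (Finset.mem_union_left _ hu)
    have hAc : (↑(ctCol G SF P w₀ R x) : Set V) ⊆ ↑((forcedGeomC G SF P w₀ R Λc kz).S x) := fun u hu => by
      rw [Finset.mem_coe] at hu ⊢; rw [hSx]; exact Finset.mem_union_left _ (Finset.mem_union_right _ hu)
    have hAz : (↑(Λc (ctColEnd G SF P w₀ R x) kz) : Set V) ⊆ ↑((forcedGeomC G SF P w₀ R Λc kz).S x) := fun u hu => by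
      rw [Finset.mem_coe] at hu ⊢; rw [hSx]; exact Finset.mem_union_right _ hu
    have hwire : ∀ u ∈ ctWire G ψ P w₀ R (lo - (j : Site 2)) (hi + (j : Site 2)) x, PathIn G (↑((forcedGeomC G SF P w₀ R Λc kz).S x) : Set V) (ctY G ψ w₀ R (lo - (j : Site 2)) (hi + (j : Site 2)) x) u :=
      fun u hu => by
        unfold ctWire at hu hAw
        exact pathIn_of_wireFinQ_subset hq _ (hw2 _) _ (hy x hx).2.2 hAw u hu
    have ht1 : ctT1 G ψ P w₀ R (lo - (j : Site 2)) (hi + (j : Site 2)) x ∈ ctWire G ψ P w₀ R (lo - (j : Site 2)) (hi + (j : Site 2)) x := by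
      unfold ctT1 ctWire; exact stemEnd_mem_wireFinQ hq _ (hw2 _) _ (hy x hx).2.2 P.d
    have hcolP : ∀ u ∈ ctCol G SF P w₀ R x, PathIn G (↑((forcedGeomC G SF P w₀ R Λc kz).S x) : Set V) (ctY G ψ w₀ R (lo - (j : Site 2)) (hi + (j : Site 2)) x) u :=
      fun u hu => (hwire _ ht1).trans ((pathIn_ctCol hstep x u hu).mono hAc)
    rw [hSx] at hv
    rcases Finset.mem_union.1 hv with hv | hv
    · rcases Finset.mem_union.1 hv with hv | hv
      · exact hwire v hv
      · exact hcolP v hv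
    · have hend := hcz (ctColEnd G SF P w₀ R x)
      exact (hcolP _ (ctColEnd_mem_ctCol x)).trans
        (((hzconn _ _ hend).symm.trans (hzconn _ v hv)).mono hAz)
  have hregC : ∀ x ∈ K, IsNear G ψ (lo - (j : Site 2)) (hi + (j : Site 2)) P w₀ R x → ((forcedGeomC G SF P w₀ R Λc kz).S x).card ≤ cS := by
    intro x hx hnear
    rw [forcedGeomC_S_of_near hnear]
    refine (Finset.card_union_le _ _).trans (le_trans (Nat.add_le_add ((Finset.card_union_le _ _).trans (Nat.add_le_add ?_ ?_)) ?_) hcS)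
    · unfold ctWire
      refine (card_wireFinQ_le _ _ _ _ _ _ _ _ _).trans ?_
      have hK' := pathLen_le (φ := ψ) (ℓs := P.ℓs) (M := P.M) (ctDir G ψ w₀ R (lo - (j : Site 2)) (hi + (j : Site 2)) x).1 (hwide (oth _)) (hy x hx).2.2
      exact Nat.add_le_add_right (Nat.mul_le_mul_left _ (by unfold ctY at hK' ⊢; omega)) _
    · exact card_ctCol_le hlip hq hw2 hKC (hx' x hx)
    · exact (Finset.card_le_card (hΛRg _)).trans (hRgcard _)
  have hfaceC : ∀ x : V, (Λc (ctColEnd G SF P w₀ R x) kz).card ≤ cU := fun x => (Finset.card_le_card (hΛRg _)).trans (hRgcard _)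
  refine ⟨fun x hx => ?_, fun x hx => ?_, fun x hx => ?_, fun x hx => ?_, fun x hx => ?_, fun x hx => ?_, fun x hx => ?_, fun x hx => ?_,
    fun x hx => ?_, fun x hx => ?_⟩
  · -- adj
    exact (hy x hx).1
  · -- y_mem
    show ctY G ψ w₀ R (lo - (j : Site 2)) (hi + (j : Site 2)) x ∈ (forcedGeomC G SF P w₀ R Λc kz).S x
    by_cases hnear : IsNear G ψ (lo - (j : Site 2)) (hi + (j : Site 2)) P w₀ R x
    · rw [forcedGeomC_S_of_near hnear]
      exact Finset.mem_union_left _ (Finset.mem_union_left _ (by unfold ctWire; exact left_mem_wireFinQ _ _ _ _ _ _ _ _ _))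
    · rw [forcedGeomC_S_of_far hnear]; exact Finset.mem_singleton_self _
  · -- S_sub
    by_cases hnear : IsNear G ψ (lo - (j : Site 2)) (hi + (j : Site 2)) P w₀ R x
    · exact hregW x hx hnear
    · intro v hv
      rw [forcedGeomC_S_of_far hnear, Finset.mem_singleton] at hv
      rw [hv]; exact hyW x hx
  · -- U_sub
    by_cases hnear : IsNear G ψ (lo - (j : Site 2)) (hi + (j : Site 2)) P w₀ R x
    · rw [forcedGeomC_U_of_near hnear]; exact (hΛRg _).trans (hRgW x hx hnear)
    · intro u hu
      rw [forcedGeomC_U_of_far hnear, Finset.mem_singleton] at hu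
      rw [hu]; exact hyW x hx
  · -- S_ball
    intro v hv
    by_cases hnear : IsNear G ψ (lo - (j : Site 2)) (hi + (j : Site 2)) P w₀ R x
    · exact graphBall_mono G x (by omega) (BoxProdZ2.mem_graphBall_add G (hy1 x hx) (hregB x hx hnear v hv))
    · rw [forcedGeomC_S_of_far hnear, Finset.mem_singleton] at hv
      rw [hv]; exact graphBall_mono G x (by omega) (hy1 x hx)
  · -- U_ball
    intro u hu
    by_cases hnear : IsNear G ψ (lo - (j : Site 2)) (hi + (j : Site 2)) P w₀ R x
    · rw [forcedGeomC_U_of_near hnear] at hu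
      exact graphBall_mono G x (by omega) (BoxProdZ2.mem_graphBall_add G (hy1 x hx) (hRgB x hx u (hΛRg _ hu)))
    · rw [forcedGeomC_U_of_far hnear, Finset.mem_singleton] at hu
      rw [hu]; exact graphBall_mono G x (by omega) (hy1 x hx)
  · -- S_path
    intro v hv
    by_cases hnear : IsNear G ψ (lo - (j : Site 2)) (hi + (j : Site 2)) P w₀ R x
    · exact hregP x hx hnear v hv
    · show PathIn G (↑((forcedGeomC G SF P w₀ R Λc kz).S x) : Set V) (ctY G ψ w₀ R (lo - (j : Site 2)) (hi + (j : Site 2)) x) v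
      rw [forcedGeomC_S_of_far hnear, Finset.mem_singleton] at hv
      rw [forcedGeomC_S_of_far hnear, hv]
      exact PathIn.refl (by simp)
  · -- U_adj
    intro u hu
    exact Or.inl (forcedGeomC_U_subset_S x hu)
  · -- S_card
    by_cases hnear : IsNear G ψ (lo - (j : Site 2)) (hi + (j : Site 2)) P w₀ R x
    · exact hregC x hx hnear
    · rw [forcedGeomC_S_of_far hnear, Finset.card_singleton]; exact h1cS
  · -- U_card
    by_cases hnear : IsNear G ψ (lo - (j : Site 2)) (hi + (j : Site 2)) P w₀ R x
    · rw [forcedGeomC_U_of_near hnear]; exact hfaceC x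
    · rw [forcedGeomC_U_of_far hnear, Finset.card_singleton]; exact hcU1

end OK

end Skelφ

end Summit.CriticalPhenomena.PercolationContinuityZ3.Theorems.Transplant

end
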